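import Summits.Parity.GeneralizedHardyLittlewood.Theorems.BeyondDiagonalBeatsQuarter.OffDiagDivisorSwitch
import Mathlib.Topology.Algebra.InfiniteSum.Basic
import HarnessLib

/-!
# Route `PrimeLevelFamEdge`, crux K_B (stmt-Parity-20343), line `diagonal_kernel_split` rev 4, plan Ω,
# sub-line Ω-e/f interface (OMEGA-BLUEPRINT L6′) — **the divisor switch for the FULL `h₂`-series:
# `Σ_{h₂∈ℤ, h₁h₂≡ab (C)} F(h₂) = Σ_{s∈ℤ, h₁∣ab+Cs} F((ab+Cs)/h₁)`**

`OffDiagDivisorSwitch.sum_hyperbola_eq_sum_switch` (p638962) switches a FINITE box `|h₂| ≤ B`. The principal part of the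
class count (a8P) is evaluated on COMPLETE `s`-sums (`OffDiagDualCompletion*`: Poisson backwards), so the switch is also
needed for the full series in `h₂` — no summability hypothesis, a re-indexing of supports (`tsum_eq_tsum_of_ne_zero_bij`):

* **`tsum_hyperbola_eq_tsum_switch`** — for `C ≥ 1`, `h₁ ≠ 0` and any `F : ℤ → M`:
  `Σ'_{h₂} 𝟙[(h₁h₂ : ZMod C) = ab]·F(h₂) = Σ'_{s} 𝟙[h₁ ∣ ab + Cs]·F((ab + Cs)/h₁)`;
* `tsum_hyperbola_eq_tsum_switch_levels` — the same read at a level `q` with `C = q·c` (the Petersson modulus), the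
  shape in which `Σ_q` (block of prime levels) meets `OffDiagLevelAP` (class `q ≡ −ab(cs)⁻¹ (mod |h₁|)`,
  `dvd_iff_natCast_level_eq`).

Pure re-indexing; theorems only; standard axioms. Helper toward `stub_offDiagBelowSlack_io`; closes nothing.
«The programme SEARCHES and TYPES; no claim about Landau–Siegel zeros, Theorems 1–2 of arXiv:2211.02515 or
a repaired Margin232 until a kernel theorem says so.»
-/

namespace Summit.Parity.GeneralizedHardyLittlewood.Theorems.BeyondDiagonalBeatsQuarter.OffDiag

open Finset Function

/-- **Divisor switch for the full `h₂`-series.** For `C ≥ 1`, `h₁ ≠ 0`, integers `a, b` and any `F`: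
`Σ'_{h₂∈ℤ} (if h₁h₂ ≡ ab (mod C) then F h₂ else 0) = Σ'_{s∈ℤ} (if h₁ ∣ ab + C·s then F((ab + C·s)/h₁) else 0)`
(the supports correspond under `s = (h₁h₂ − ab)/C`, `h₂ = (ab + Cs)/h₁`). [folklore] -/
theorem tsum_hyperbola_eq_tsum_switch {M : Type*} [AddCommMonoid M] [TopologicalSpace M]
    {C : ℕ} (hC : 1 ≤ C) {a b h₁ : ℤ} (hh₁ : h₁ ≠ 0) (F : ℤ → M) :
    ∑' h₂ : ℤ, (if (h₁ : ZMod C) * (h₂ : ZMod C) = (a : ZMod C) * (b : ZMod C) then F h₂ else 0) =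
      ∑' s : ℤ, (if h₁ ∣ a * b + (C : ℤ) * s then F ((a * b + (C : ℤ) * s) / h₁) else 0) := by
  classical
  have hC' : (C : ℤ) ≠ 0 := by exact_mod_cast (show C ≠ 0 by omega)
  -- bijection from the support of the `s`-summand to `h₂ = (ab + Cs)/h₁`
  refine tsum_eq_tsum_of_ne_zero_bij
    (g := fun s : ℤ ↦ (if h₁ ∣ a * b + (C : ℤ) * s then F ((a * b + (C : ℤ) * s) / h₁) else 0))
    (fun s ↦ (a * b + (C : ℤ) * (s : ℤ)) / h₁) ?_ ?_ ?_
  · -- injective on the support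
    rintro ⟨s, hs⟩ ⟨s', hs'⟩ h
    simp only [Function.mem_support, ne_eq, ite_eq_right_iff, Classical.not_imp] at hs hs'
    obtain ⟨⟨t, ht⟩, -⟩ := hs
    obtain ⟨⟨t', ht'⟩, -⟩ := hs'
    simp only [Subtype.mk.injEq]
    simp only at h
    rw [ht, ht', Int.mul_ediv_cancel_left _ hh₁, Int.mul_ediv_cancel_left _ hh₁] at h
    subst h
    have : (C : ℤ) * s = (C : ℤ) * s' := by linarith
    exact mul_left_cancel₀ hC' this
  · -- the support of the `h₂`-summand is in the range
    intro h₂ hh₂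
    simp only [Function.mem_support, ne_eq, ite_eq_right_iff, Classical.not_imp] at hh₂
    obtain ⟨hcong, hF⟩ := hh₂
    obtain ⟨s, hs⟩ := (intCast_mul_eq_iff_exists a b h₁ h₂).mp hcong
    have hdvd : h₁ ∣ a * b + (C : ℤ) * s := ⟨h₂, by rw [← hs, mul_comm]⟩
    have hval : (a * b + (C : ℤ) * s) / h₁ = h₂ := by rw [← hs, mul_comm, Int.mul_ediv_cancel _ hh₁]
    refine ⟨⟨s, ?_⟩, hval⟩
    simp only [Function.mem_support, ne_eq, ite_eq_right_iff, Classical.not_imp]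
    exact ⟨hdvd, by rwa [hval]⟩
  · -- values agree
    rintro ⟨s, hs⟩
    have hd : h₁ ∣ a * b + (C : ℤ) * s := by
      by_contra hnd
      exact hs (by simp only [if_neg hnd])
    obtain ⟨t, ht⟩ := hd
    have hval : (a * b + (C : ℤ) * s) / h₁ = t := by rw [ht, Int.mul_ediv_cancel_left _ hh₁]
    have hcong : (h₁ : ZMod C) * (t : ZMod C) = (a : ZMod C) * (b : ZMod C) := by
      rw [intCast_mul_eq_iff_exists]
      exact ⟨s, by rw [← ht]⟩
    simp only [hval, if_pos hcong, if_pos (show h₁ ∣ a * b + (C : ℤ) * s from ⟨t, ht⟩)]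

/-- **At a level `q` (Petersson modulus `C = q·c`)**: `Σ'_{h₂} 𝟙[h₁h₂ ≡ ab (qc)]·F(h₂) =
Σ'_{s} 𝟙[h₁ ∣ ab + q·c·s]·F((ab + qcs)/h₁)` — for fixed `(h₁, c, s)` the condition on the level `q` is
`h₁ ∣ ab + q·(cs)`, an arithmetic progression mod `|h₁|` (`dvd_iff_natCast_level_eq`). [folklore] -/
theorem tsum_hyperbola_eq_tsum_switch_levels {M : Type*} [AddCommMonoid M] [TopologicalSpace M]
    {q c : ℕ} (hq : 1 ≤ q) (hc : 1 ≤ c) {a b h₁ : ℤ} (hh₁ : h₁ ≠ 0) (F : ℤ → M) :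
    ∑' h₂ : ℤ, (if (h₁ : ZMod (q * c)) * (h₂ : ZMod (q * c)) = (a : ZMod (q * c)) * (b : ZMod (q * c))
        then F h₂ else 0) =
      ∑' s : ℤ, (if h₁ ∣ a * b + (q : ℤ) * ((c : ℤ) * s) then F ((a * b + (q : ℤ) * ((c : ℤ) * s)) / h₁) else 0) := by
  have h := tsum_hyperbola_eq_tsum_switch (M := M) (C := q * c) (Nat.one_le_iff_ne_zero.mpr
    (Nat.mul_ne_zero (by omega) (by omega))) (a := a) (b := b) hh₁ F
  simp only [Nat.cast_mul, mul_assoc] at h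
  exact h

end Summit.Parity.GeneralizedHardyLittlewood.Theorems.BeyondDiagonalBeatsQuarter.OffDiag
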